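import Mathlib

/-!
# Route «KPlusLogSqLaw», crux `TropicalB` (stmt-ValiantsHypothesis-19771) — CLASS CIRCUITS: a balanced family of class moves splits
# into simple circuits, so an «up-pointing» potential of the simple circuits bounds the whole step (part 1 of the TWO-SIDED SEPARABLE
# sector law)

HONEST FRAMING.  Helper toward the registered stubs `stub_tropThin` / `stub_tropFat` of `Cruxes/TropicalB/Lines/birth.lean` (crux
`Summit.ValiantsHypothesis.ValiantsHypothesis.Theses.KPlusLogSqLaw.TropicalB`, item stmt-ValiantsHypothesis-19771, route KPlusLogSqLaw;
cell `pub-symmetroid`, seat val-sym-trop-p1 g19, 2026-08-28; `--supports … --as helper`).  Pure combinatorics of finite directed multigraphs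
on the class set `Fin K` (no designs here); part 2 (`…TropicalBTwoSidedSeparable`) applies it to dominant chains.  Nothing in this file
bounds `TropicalB`, and nothing bears on `WeakLifting`, DoorA26 / DoorA34, `MatrixDescartes` (stmt-ValiantsHypothesis-18050) or VP ≠ VNP.

THE SETTING.  A finite family `D` of ARCS `i` (an index type `ι`), each with a tail class `tl i` and a head class `hd i` in `Fin K`.
`D` is BALANCED when every class has as many incoming as outgoing arcs of `D`
(`(D.filter (hd · = l)).card = (D.filter (tl · = l)).card` for all `l`), and SIMPLE when every class is the head of at most one arc of
`D`.  In part 2 the arcs are the agents (rows and columns of a dominance design) that change class between two consecutive dominant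
terms; balance is the bookkeeping identity «row histogram = column histogram» of a Leibniz term.

* `exists_circuit` — **every nonempty balanced family contains a nonempty balanced simple sub-family** (a simple directed circuit:
  walk along arcs, which is always possible by balance, until a tail class repeats — pigeonhole in `K + 1` steps — and keep the
  arcs between the two visits of the first repeated class).
* `circuit_potential` — **the circuit potential lemma**: let `f g : ι → ℤ` be per-arc weights («slope increment» and «potential
  increment»).  If every nonempty balanced simple `S ⊆ D` has `0 ≤ Σ_S g` and `0 < Σ_S f → 1 ≤ Σ_S g`, then the balanced family
  `D` itself has `0 ≤ Σ_D g` and `0 < Σ_D f → 1 ≤ Σ_D g` (peel off circuits; strong induction on `#D`).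

[folklore: Euler's decomposition of a balanced digraph into circuits; the potential bookkeeping is this file's]
-/

set_option linter.dupNamespace false
set_option autoImplicit false

namespace Summit.ValiantsHypothesis.ValiantsHypothesis.Theorems.KPlusLogSqLaw

namespace ClassCircuit

open Finset

variable {ι : Type*} [DecidableEq ι] {K : ℕ}

/-- **Circuit extraction.**  A nonempty family of arcs on `Fin K` in which every class has equally many incoming and outgoing
arcs contains a nonempty sub-family with the same property in which, moreover, every class is the head (hence also the tail) of
at most one arc. [folklore: Euler] -/
theorem exists_circuit (tl hd : ι → Fin K) (D : Finset ι)
    (hbal : ∀ l, (D.filter fun i => hd i = l).card = (D.filter fun i => tl i = l).card) (hne : D.Nonempty) :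
    ∃ S ⊆ D, S.Nonempty ∧ (∀ l, (S.filter fun i => hd i = l).card = (S.filter fun i => tl i = l).card) ∧
      (∀ l, (S.filter fun i => hd i = l).card ≤ 1) := by
  classical
  obtain ⟨i₀, hi₀⟩ := hne
  -- every arc of `D` is followed by an arc of `D`
  have hnext : ∀ i ∈ D, ∃ j ∈ D, tl j = hd i := by
    intro i hi
    have h1 : 0 < (D.filter fun j => hd j = hd i).card :=
      Finset.card_pos.mpr ⟨i, Finset.mem_filter.mpr ⟨hi, rfl⟩⟩
    rw [hbal (hd i)] at h1
    obtain ⟨j, hj⟩ := Finset.card_pos.mp h1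
    exact ⟨j, (Finset.mem_filter.mp hj).1, (Finset.mem_filter.mp hj).2⟩
  choose! nx hnxD hnxtl using hnext
  -- the walk
  let seq : ℕ → ι := fun n => nx^[n] i₀
  have hseqD : ∀ n, seq n ∈ D := by
    intro n
    induction n with
    | zero => exact hi₀
    | succ n ih =>
      show nx^[n + 1] i₀ ∈ D
      rw [Function.iterate_succ_apply']
      exact hnxD _ ih
  have hstep : ∀ n, tl (seq (n + 1)) = hd (seq n) := by
    intro n
    show tl (nx^[n + 1] i₀) = hd (nx^[n] i₀)
    rw [Function.iterate_succ_apply']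
    exact hnxtl _ (hseqD n)
  -- a tail class repeats within `K + 1` steps
  have hex : ∃ t, ∃ s, s < t ∧ tl (seq s) = tl (seq t) := by
    obtain ⟨a, b, hab, heq⟩ :=
      Fintype.exists_ne_map_eq_of_card_lt (fun n : Fin (K + 1) => tl (seq n)) (by simp)
    rcases lt_or_gt_of_ne hab with h | h
    · exact ⟨b, a, by exact_mod_cast h, heq⟩
    · exact ⟨a, b, by exact_mod_cast h, heq.symm⟩
  -- the first repetition
  let t := Nat.find hex
  obtain ⟨s, hst, hts⟩ : ∃ s, s < t ∧ tl (seq s) = tl (seq t) := Nat.find_spec hex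
  have hmin : ∀ x y, x < y → y < t → tl (seq x) ≠ tl (seq y) := by
    intro x y hxy hyt h
    exact (Nat.find_min hex hyt) ⟨x, hxy, h⟩
  have hinj : ∀ x y, x < t → y < t → tl (seq x) = tl (seq y) → x = y := by
    intro x y hx hy h
    by_contra hne
    rcases lt_or_gt_of_ne hne with hlt | hlt
    · exact hmin x y hlt hy h
    · exact hmin y x hlt hx h.symm
  -- the circuit: the arcs `seq s, …, seq (t-1)`
  refine ⟨(Finset.Ico s t).image seq, ?_, ?_, ?_, ?_⟩
  · intro i hi
    obtain ⟨n, -, rfl⟩ := Finset.mem_image.mp hi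
    exact hseqD n
  · exact (Finset.nonempty_Ico.mpr hst).image _
  · -- balanced: heads of the circuit = tails of the circuit, both without repetition
    intro l
    have htl1 : ((Finset.Ico s t).image seq |>.filter fun i => tl i = l).card ≤ 1 := by
      refine Finset.card_le_one.mpr ?_
      intro i hi j hj
      obtain ⟨hi, hil⟩ := Finset.mem_filter.mp hi
      obtain ⟨hj, hjl⟩ := Finset.mem_filter.mp hj
      obtain ⟨x, hx, rfl⟩ := Finset.mem_image.mp hi
      obtain ⟨y, hy, rfl⟩ := Finset.mem_image.mp hj
      rw [Finset.mem_Ico] at hx hy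
      rw [hinj x y hx.2 hy.2 (hil.trans hjl.symm)]
    have hhd1 : ((Finset.Ico s t).image seq |>.filter fun i => hd i = l).card ≤ 1 := by
      refine Finset.card_le_one.mpr ?_
      intro i hi j hj
      obtain ⟨hi, hil⟩ := Finset.mem_filter.mp hi
      obtain ⟨hj, hjl⟩ := Finset.mem_filter.mp hj
      obtain ⟨x, hx, rfl⟩ := Finset.mem_image.mp hi
      obtain ⟨y, hy, rfl⟩ := Finset.mem_image.mp hj
      rw [Finset.mem_Ico] at hx hy
      rw [← hstep] at hil hjl
      -- tails at `x+1` and `y+1` agree; reduce indices equal to `t` to `s`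
      have key : ∀ z, s ≤ z → z < t → ∃ z', z' < t ∧ tl (seq (z + 1)) = tl (seq z') ∧ (z' = if z + 1 = t then s else z + 1) := by
        intro z hz hzt
        by_cases h : z + 1 = t
        · exact ⟨s, hst, by rw [h, hts], by simp [h]⟩
        · exact ⟨z + 1, by omega, rfl, by simp [h]⟩
      obtain ⟨x', hx', hxe, hxd⟩ := key x hx.1 hx.2
      obtain ⟨y', hy', hye, hyd⟩ := key y hy.1 hy.2
      have hxy' : x' = y' := hinj x' y' hx' hy' (by rw [← hxe, ← hye, hil, hjl])
      have : x = y := by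
        subst hxd; subst hyd
        by_cases hx1 : x + 1 = t <;> by_cases hy1 : y + 1 = t <;> simp [hx1, hy1] at hxy' <;> omega
      rw [this]
    -- existence of a head `l` iff existence of a tail `l`
    have hiff : (∃ i ∈ (Finset.Ico s t).image seq, hd i = l) ↔ (∃ i ∈ (Finset.Ico s t).image seq, tl i = l) := by
      constructor
      · rintro ⟨i, hi, hil⟩
        obtain ⟨x, hx, rfl⟩ := Finset.mem_image.mp hi
        rw [Finset.mem_Ico] at hx
        rw [← hstep] at hil
        by_cases h : x + 1 = t
        · refine ⟨seq s, Finset.mem_image.mpr ⟨s, Finset.mem_Ico.mpr ⟨le_rfl, hst⟩, rfl⟩, ?_⟩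
          rw [hts, ← h, hil]
        · exact ⟨seq (x + 1), Finset.mem_image.mpr ⟨x + 1, Finset.mem_Ico.mpr ⟨by omega, by omega⟩, rfl⟩, hil⟩
      · rintro ⟨i, hi, hil⟩
        obtain ⟨y, hy, rfl⟩ := Finset.mem_image.mp hi
        rw [Finset.mem_Ico] at hy
        by_cases h : y = s
        · refine ⟨seq (t - 1), Finset.mem_image.mpr ⟨t - 1, Finset.mem_Ico.mpr ⟨by omega, by omega⟩, rfl⟩, ?_⟩
          have ht1 : t - 1 + 1 = t := by omega
          rw [← hstep, ht1, ← hts, ← h, hil]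
        · refine ⟨seq (y - 1), Finset.mem_image.mpr ⟨y - 1, Finset.mem_Ico.mpr ⟨by omega, by omega⟩, rfl⟩, ?_⟩
          have hy1 : y - 1 + 1 = y := by omega
          rw [← hstep, hy1, hil]
    -- both counts are `1` if `l` occurs and `0` otherwise
    rcases Nat.le_one_iff_eq_zero_or_eq_one.mp htl1 with h0 | h1
    · rw [h0]
      rw [Finset.card_eq_zero, Finset.filter_eq_empty_iff] at h0 ⊢
      intro i hi hil
      obtain ⟨j, hj, hjl⟩ := hiff.mp ⟨i, hi, hil⟩
      exact h0 hj hjl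
    · rw [h1]
      refine le_antisymm hhd1 ?_
      obtain ⟨j, hj⟩ := Finset.card_pos.mp (by omega : 0 < ((Finset.Ico s t).image seq |>.filter fun i => tl i = l).card)
      obtain ⟨hj, hjl⟩ := Finset.mem_filter.mp hj
      obtain ⟨i, hi, hil⟩ := hiff.mpr ⟨j, hj, hjl⟩
      exact Finset.card_pos.mpr ⟨i, Finset.mem_filter.mpr ⟨hi, hil⟩⟩
  · intro l
    refine Finset.card_le_one.mpr ?_
    intro i hi j hj
    obtain ⟨hi, hil⟩ := Finset.mem_filter.mp hi
    obtain ⟨hj, hjl⟩ := Finset.mem_filter.mp hj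
    obtain ⟨x, hx, rfl⟩ := Finset.mem_image.mp hi
    obtain ⟨y, hy, rfl⟩ := Finset.mem_image.mp hj
    rw [Finset.mem_Ico] at hx hy
    rw [← hstep] at hil hjl
    by_cases hx1 : x + 1 = t <;> by_cases hy1 : y + 1 = t
    · rw [show x = y by omega]
    · exfalso
      have h1 : tl (seq s) = tl (seq (y + 1)) := by rw [hts, ← hx1, hil, hjl]
      have := hinj s (y + 1) hst (by omega) h1
      omega
    · exfalso
      have h1 : tl (seq s) = tl (seq (x + 1)) := by rw [hts, ← hy1, hjl, hil]
      have := hinj s (x + 1) hst (by omega) h1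
      omega
    · rw [show x = y by have := hinj (x + 1) (y + 1) (by omega) (by omega) (hil.trans hjl.symm); omega]

/-- **The circuit potential lemma.**  Per-arc weights `f` (slope) and `g` (potential); if every nonempty balanced simple
sub-family `S ⊆ D` has `0 ≤ Σ_S g` and `0 < Σ_S f → 1 ≤ Σ_S g`, then so does the balanced family `D`. [this file] -/
theorem circuit_potential (tl hd : ι → Fin K) (f g : ι → ℤ) (D : Finset ι)
    (hbal : ∀ l, (D.filter fun i => hd i = l).card = (D.filter fun i => tl i = l).card)
    (H : ∀ S ⊆ D, S.Nonempty → (∀ l, (S.filter fun i => hd i = l).card = (S.filter fun i => tl i = l).card) →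
      (∀ l, (S.filter fun i => hd i = l).card ≤ 1) → 0 ≤ ∑ i ∈ S, g i ∧ (0 < ∑ i ∈ S, f i → 1 ≤ ∑ i ∈ S, g i)) :
    0 ≤ ∑ i ∈ D, g i ∧ (0 < ∑ i ∈ D, f i → 1 ≤ ∑ i ∈ D, g i) := by
  classical
  induction hD : D.card using Nat.strong_induction_on generalizing D with
  | _ N ih =>
    rcases D.eq_empty_or_nonempty with rfl | hne
    · simp
    obtain ⟨S, hSD, hSne, hSbal, hSsimp⟩ := exists_circuit tl hd D hbal hne
    have hS := H S hSD hSne hSbal hSsimp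
    -- the rest `D \ S` is balanced and smaller
    have hfs : ∀ (P : ι → Prop) [DecidablePred P], (D \ S).filter P = D.filter P \ S.filter P := by
      intro P _
      ext i
      simp only [Finset.mem_filter, Finset.mem_sdiff]
      tauto
    have hrest_bal : ∀ l, ((D \ S).filter fun i => hd i = l).card = ((D \ S).filter fun i => tl i = l).card := by
      intro l
      rw [hfs, hfs, Finset.card_sdiff_of_subset (Finset.filter_subset_filter _ hSD),
        Finset.card_sdiff_of_subset (Finset.filter_subset_filter _ hSD), hbal l, hSbal l]
    have hlt : (D \ S).card < N := by
      rw [← hD, Finset.card_sdiff_of_subset hSD]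
      have := Finset.card_pos.mpr hSne
      have := Finset.card_le_card hSD
      omega
    have hrest := ih _ hlt (D \ S) hrest_bal (fun T hT => H T (hT.trans Finset.sdiff_subset)) rfl
    have hsumf : ∑ i ∈ D, f i = ∑ i ∈ D \ S, f i + ∑ i ∈ S, f i := (Finset.sum_sdiff hSD).symm
    have hsumg : ∑ i ∈ D, g i = ∑ i ∈ D \ S, g i + ∑ i ∈ S, g i := (Finset.sum_sdiff hSD).symm
    refine ⟨by rw [hsumg]; linarith [hrest.1, hS.1], fun hpos => ?_⟩
    rw [hsumg]
    rw [hsumf] at hpos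
    by_cases h : 0 < ∑ i ∈ S, f i
    · linarith [hS.2 h, hrest.1]
    · have h' : 0 < ∑ i ∈ D \ S, f i := by linarith
      linarith [hrest.2 h', hS.1]

end ClassCircuit

end Summit.ValiantsHypothesis.ValiantsHypothesis.Theorems.KPlusLogSqLaw
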